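import Literature.MathematicalPhysics.QuantumLattice.HubbardRestrictedEtaPairCommutator
import Literature.MathematicalPhysics.QuantumLattice.HubbardWave0LiebProofs
import Literature.MathematicalPhysics.QuantumLattice.PairFieldMomentum
import HarnessLib

/-!
# Local stability against removing the `η`-pairs of a region: `Re φ(P Pᴴ) ≤ 4 (k(|V| − |W|))² / (U − 2μ)²`

Topic `Literature/MathematicalPhysics/QuantumLattice` (family `hubbard`; cell `hubbard-obs`, seat `hubbard-obs-p1`).
Sequel of `HubbardRestrictedEtaPairCommutator.lean` (Yang's commutator for the restricted pair-creator sum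
`P = Σ_w ε_{ι w} c†_{ι w↑} c†_{ι w↓}` with its boundary term `D_∂`). For a normalised, Hermitian, positive linear
functional `φ` on the CAR matrices of a finite vertex set (the restriction of any state) this file proves the
elementary positivity bookkeeping (AM–GM `2s Re φ(XYᴴ) ≤ s² Re φ(XXᴴ) + Re φ(YYᴴ)`; `Re φ(P) ≤ 1` for a projection;
`Re φ((Σᵢyᵢ)(Σᵢyᵢ)ᴴ) ≤ |I| Σᵢ Re φ(yᵢyᵢᴴ)`; `Re φ(K Kᴴ) ≤ 4` for the bond pair creator `K`; hence
`Re φ(D_∂ D_∂ᴴ) ≤ 4 n_∂²`, `n_∂ ≤ k(|V| − |W|)` the number of boundary pairs when every site has `≤ k` inner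
neighbours) and THE MECHANISM in abstract form (`re_map_restrictedEtaRaise_mul_conjTranspose_le`):

  if `2μ < U` and `φ` obeys the Bratteli–Robinson ground-state inequality for the test operator `A = Pᴴ = η_W`
  and `K = H(1,U) − μN`, i.e. `Re φ(P (K Pᴴ − Pᴴ K)) ≥ 0`, then `Re φ(P Pᴴ) ≤ 4 (k(|V| − |W|))² / (U − 2μ)²`.

Indeed `K Pᴴ − Pᴴ K = −(U − 2μ)Pᴴ + D_∂ᴴ` (adjoint of Yang's commutator), so stability says
`(U − 2μ) φ(PPᴴ) ≤ Re φ(P D_∂ᴴ)`, and AM–GM with the boundary bound closes. Everything PROVED; no definition,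
no named fact, no `sorry`. Used by `HubbardEtaPairingNoLROBelowHalfCoupling.lean` with `φ` = the restriction of an
infinite-volume ground state to a window of `ℤ²`.

## Sources
O. Bratteli, D. W. Robinson, *Operator Algebras and Quantum Statistical Mechanics 1* (2nd ed. 1987), §2.3.2 and
Lemma 2.3.10 (positive functionals, Cauchy–Schwarz) [cite: BratteliRobinsonI1987, Lemma 2.3.10]; *… 2* (2nd ed.
1997), Prop. 5.3.19 (local stability of ground states) [cite: BratteliRobinsonII1997, Prop. 5.3.19]; C. N. Yang,
PRL **63** (1989) 2144, eq. (6) [cite: Yang1989, eq. (6)]. The combination is in-house bookkeeping.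
-/

noncomputable section

namespace Literature.MathematicalPhysics.QuantumLattice

open Matrix Finset HubbardWave0
open scoped ComplexOrder

section Functional

variable {V : Type*} [LinearOrder V] [Fintype V] {W : Type*} [Fintype W]

/-! ### §1b Positive functionals on the CAR matrices: AM–GM, sums, and the size of the boundary term -/

variable (φ : Matrix (Finset (Orb V)) (Finset (Orb V)) ℂ →ₗ[ℂ] ℂ)

/-- **AM–GM for a Hermitian positive functional**: `2s Re φ(X Yᴴ) ≤ s² Re φ(X Xᴴ) + Re φ(Y Yᴴ)` for real `s`
(positivity of `φ` on `(sX − Y)(sX − Y)ᴴ`). [cite: BratteliRobinsonI1987, Lemma 2.3.10] -/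
theorem re_map_mul_conjTranspose_amgm (hφ : ∀ A, 0 ≤ φ (Aᴴ * A)) (hφH : ∀ A, φ Aᴴ = star (φ A))
    (X Y : Matrix (Finset (Orb V)) (Finset (Orb V)) ℂ) (s : ℝ) :
    2 * s * (φ (X * Yᴴ)).re ≤ s ^ 2 * (φ (X * Xᴴ)).re + (φ (Y * Yᴴ)).re := by
  have hYX : (φ (Y * Xᴴ)).re = (φ (X * Yᴴ)).re := by
    have : Y * Xᴴ = (X * Yᴴ)ᴴ := by rw [conjTranspose_mul, conjTranspose_conjTranspose]
    rw [this, hφH, Complex.star_def, Complex.conj_re]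
  have h0 := hφ (((s : ℂ) • X - Y)ᴴ)
  rw [conjTranspose_conjTranspose] at h0
  have hexp : ((s : ℂ) • X - Y) * ((s : ℂ) • X - Y)ᴴ =
      (s : ℂ) • ((s : ℂ) • (X * Xᴴ)) - (s : ℂ) • (X * Yᴴ) - (s : ℂ) • (Y * Xᴴ) + Y * Yᴴ := by
    rw [conjTranspose_sub, conjTranspose_smul, Complex.star_def, Complex.conj_ofReal]
    simp only [sub_mul, mul_sub, smul_mul_assoc, mul_smul_comm, smul_sub]
    abel
  rw [hexp] at h0
  obtain ⟨hre, -⟩ := Complex.nonneg_iff.1 h0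
  simp only [map_add, map_sub, map_smul, smul_eq_mul, Complex.add_re, Complex.sub_re, Complex.mul_re,
    Complex.ofReal_re, Complex.ofReal_im, zero_mul, sub_zero, Complex.mul_im, add_zero] at hre
  rw [hYX] at hre
  nlinarith [hre]

/-- **A projection has expectation at most one** in a normalised positive functional: `Re φ(P) ≤ 1` for a Hermitian
idempotent `P` (apply positivity to `1 − P = (1 − P)ᴴ(1 − P)`). [cite: BratteliRobinsonI1987, §2.3.2] -/
theorem re_map_le_one_of_isHermitian_of_isIdempotentElem (hφ : ∀ A, 0 ≤ φ (Aᴴ * A)) (hφ1 : φ 1 = 1)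
    {P : Matrix (Finset (Orb V)) (Finset (Orb V)) ℂ} (hP : P.IsHermitian) (hP2 : IsIdempotentElem P) :
    (φ P).re ≤ 1 := by
  have hQ : (1 - P).IsHermitian := Matrix.isHermitian_one.sub hP
  have hQ2 : IsIdempotentElem (1 - P) := hP2.one_sub
  have h := hφ (1 - P)
  rw [hQ.eq, hQ2.eq, map_sub, hφ1] at h
  have := (Complex.nonneg_iff.1 h).1
  rw [Complex.sub_re, Complex.one_re] at this
  linarith

/-- `Re φ(c†_a c†_b (c†_a c†_b)ᴴ) ≤ 1` for distinct orbitals `a ≠ b`: the product is the projection `n_a n_b`.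
[cite: BratteliRobinsonI1987, §2.3.2] -/
theorem re_map_pairCreation_mul_conjTranspose_le_one (hφ : ∀ A, 0 ≤ φ (Aᴴ * A)) (hφ1 : φ 1 = 1)
    {a b : Orb V} (hab : a ≠ b) :
    (φ (creation a * creation b * (creation a * creation b)ᴴ)).re ≤ 1 := by
  have hcomm : numberAt b * annihilation a = annihilation a * numberAt b := by
    have h := congrArg conjTranspose (number_mul_creation_of_ne hab.symm)
    simp only [conjTranspose_mul, creation_conjTranspose, annihilation_conjTranspose] at h
    -- h : (c†_a)ᴴ… : creation a ᴴ * (n_b)ᴴ = (n_b)ᴴ * … ; tidy up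
    rw [numberAt]
    simpa [mul_assoc] using h.symm
  have hprod : creation a * creation b * (creation a * creation b)ᴴ = numberAt a * numberAt b := by
    rw [conjTranspose_mul, creation_conjTranspose, creation_conjTranspose, numberAt, numberAt]
    calc creation a * creation b * (annihilation b * annihilation a)
        = creation a * ((creation b * annihilation b) * annihilation a) := by simp only [mul_assoc]
      _ = creation a * (annihilation a * (creation b * annihilation b)) := by
          rw [show creation b * annihilation b = numberAt b from rfl, hcomm]
      _ = creation a * annihilation a * (creation b * annihilation b) := by simp only [mul_assoc]
  rw [hprod]
  have hPQ := (numberAt_idempotent a).mul_of_commute (numberAt_commute a b) (numberAt_idempotent b)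
  have hPH : (numberAt a * numberAt b).IsHermitian := by
    rw [Matrix.IsHermitian, conjTranspose_mul, (numberAt_isHermitian a).eq, (numberAt_isHermitian b).eq,
      (numberAt_commute a b).eq]
  exact re_map_le_one_of_isHermitian_of_isIdempotentElem φ hφ hφ1 hPH hPQ

/-- **Sums of squares**: `Re φ((Σᵢ yᵢ)(Σᵢ yᵢ)ᴴ) ≤ |I| Σᵢ Re φ(yᵢ yᵢᴴ)` (pairwise AM–GM).
[cite: BratteliRobinsonI1987, Lemma 2.3.10] -/
theorem re_map_sum_mul_conjTranspose_le (hφ : ∀ A, 0 ≤ φ (Aᴴ * A)) (hφH : ∀ A, φ Aᴴ = star (φ A))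
    {κ : Type*} (I : Finset κ) (y : κ → Matrix (Finset (Orb V)) (Finset (Orb V)) ℂ) :
    (φ ((∑ i ∈ I, y i) * (∑ i ∈ I, y i)ᴴ)).re ≤ #I * ∑ i ∈ I, (φ (y i * (y i)ᴴ)).re := by
  set a : κ → ℝ := fun i => (φ (y i * (y i)ᴴ)).re with ha
  calc (φ ((∑ i ∈ I, y i) * (∑ i ∈ I, y i)ᴴ)).re
      = ∑ i ∈ I, ∑ j ∈ I, (φ (y i * (y j)ᴴ)).re := by
        rw [conjTranspose_sum, sum_mul_sum, map_sum, Complex.re_sum]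
        refine sum_congr rfl fun i _ => ?_
        rw [map_sum, Complex.re_sum]
    _ ≤ ∑ i ∈ I, ∑ j ∈ I, (a i / 2 + a j / 2) := by
        refine sum_le_sum fun i _ => sum_le_sum fun j _ => ?_
        have h := re_map_mul_conjTranspose_amgm φ hφ hφH (y i) (y j) 1
        simp only [ha]
        linarith
    _ = #I * ∑ i ∈ I, a i := by
        simp only [sum_add_distrib, sum_const, nsmul_eq_mul]
        rw [← mul_sum, ← sum_div]
        ring

/-- `Re φ(K Kᴴ) ≤ 4` for the bond pair creator `K(x,z) = c†_{x↑} c†_{z↓} − c†_{x↓} c†_{z↑}` (each of the two products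
`c†c† (c†c†)ᴴ` is a projection). [cite: BratteliRobinsonI1987, §2.3.2] -/
theorem re_map_pairCreationBond_mul_conjTranspose_le_four (hφ : ∀ A, 0 ≤ φ (Aᴴ * A))
    (hφH : ∀ A, φ Aᴴ = star (φ A)) (hφ1 : φ 1 = 1) (x z : V) :
    (φ ((creation (orb x 0) * creation (orb z 1) - creation (orb x 1) * creation (orb z 0)) *
      (creation (orb x 0) * creation (orb z 1) - creation (orb x 1) * creation (orb z 0))ᴴ)).re ≤ 4 := by
  set u := creation (orb x 0) * creation (orb z 1) with hu
  set v := creation (orb x 1) * creation (orb z 0) with hv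
  have hvu : (φ (v * uᴴ)).re = (φ (u * vᴴ)).re := by
    have : v * uᴴ = (u * vᴴ)ᴴ := by rw [conjTranspose_mul u vᴴ, conjTranspose_conjTranspose]
    rw [this, hφH, Complex.star_def, Complex.conj_re]
  have hexp : (u - v) * (u - v)ᴴ = u * uᴴ - u * vᴴ - v * uᴴ + v * vᴴ := by
    rw [conjTranspose_sub]; noncomm_ring
  have ham := re_map_mul_conjTranspose_amgm φ hφ hφH u v (-1)
  have hu1 := re_map_pairCreation_mul_conjTranspose_le_one φ hφ hφ1 (a := orb x 0) (b := orb z 1) (by simp)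
  have hv1 := re_map_pairCreation_mul_conjTranspose_le_one φ hφ hφ1 (a := orb x 1) (b := orb z 0) (by simp)
  rw [hexp, map_add, map_sub, map_sub, Complex.add_re, Complex.sub_re, Complex.sub_re, hvu]
  simp only [hu, hv] at hu1 hv1 ham ⊢
  nlinarith [hu1, hv1, ham]

/-- **The boundary term is small in mean square**: for the boundary pair-creation sum
`D_∂ = Σ_{x ∉ ι(W)} Σ_{w : x ∼ ι w} ε_{ι w} K(x, ι w)` with `n_∂` terms, `Re φ(D_∂ D_∂ᴴ) ≤ 4 n_∂²`; here
`n_∂ ≤ k · (|V| − |W|)` when every site has at most `k` inner neighbours. [cite: BratteliRobinsonI1987, Lemma 2.3.10] -/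
theorem re_map_boundary_mul_conjTranspose_le (hφ : ∀ A, 0 ≤ φ (Aᴴ * A)) (hφH : ∀ A, φ Aᴴ = star (φ A))
    (hφ1 : φ 1 = 1) (G : SimpleGraph V) [DecidableRel G.Adj] (ι : W ↪ V) (ε : V → ℤˣ) (k : ℕ)
    (hdeg : ∀ x : V, #(univ.filter fun w : W => G.Adj x (ι w)) ≤ k) :
    (φ ((∑ x ∈ (univ.map ι)ᶜ, ∑ w, if G.Adj x (ι w) then
          ((ε (ι w) : ℤ) : ℂ) • (creation (orb x 0) * creation (orb (ι w) 1) - creation (orb x 1) * creation (orb (ι w) 0))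
          else 0) *
        (∑ x ∈ (univ.map ι)ᶜ, ∑ w, if G.Adj x (ι w) then
          ((ε (ι w) : ℤ) : ℂ) • (creation (orb x 0) * creation (orb (ι w) 1) - creation (orb x 1) * creation (orb (ι w) 0))
          else 0)ᴴ)).re ≤
      4 * ((k : ℝ) * (Fintype.card V - Fintype.card W)) ^ 2 := by
  classical
  set K : V → V → Matrix (Finset (Orb V)) (Finset (Orb V)) ℂ := fun x z =>
    creation (orb x 0) * creation (orb z 1) - creation (orb x 1) * creation (orb z 0) with hK
  set B : Finset (V × W) := ((univ.map ι)ᶜ ×ˢ (univ : Finset W)).filter fun p => G.Adj p.1 (ι p.2) with hB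
  have hD : (∑ x ∈ (univ.map ι)ᶜ, ∑ w, if G.Adj x (ι w) then ((ε (ι w) : ℤ) : ℂ) • K x (ι w) else 0) =
      ∑ p ∈ B, ((ε (ι p.2) : ℤ) : ℂ) • K p.1 (ι p.2) := by
    rw [hB, sum_filter, ← sum_product']
  -- the number of boundary pairs
  have hcardB : (#B : ℝ) ≤ (k : ℝ) * (Fintype.card V - Fintype.card W) := by
    have h1 : #B ≤ ∑ x ∈ (univ.map ι)ᶜ, #(univ.filter fun w : W => G.Adj x (ι w)) := by
      rw [hB, card_filter, sum_product]
      refine (sum_le_sum fun x _ => ?_).trans le_rfl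
      rw [← card_filter]
    have h2 : ∑ x ∈ (univ.map ι)ᶜ, #(univ.filter fun w : W => G.Adj x (ι w)) ≤ #((univ.map ι)ᶜ : Finset V) * k :=
      (sum_le_sum fun x _ => hdeg x).trans (by rw [sum_const, smul_eq_mul])
    have h3 : #((univ.map ι)ᶜ : Finset V) = Fintype.card V - Fintype.card W := by
      rw [card_compl, card_map, card_univ]
    have hle : Fintype.card W ≤ Fintype.card V := Fintype.card_le_of_embedding ι
    have h4 : (#B : ℝ) ≤ ((Fintype.card V - Fintype.card W : ℕ) : ℝ) * k := by
      rw [← h3]; exact_mod_cast h1.trans h2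
    rw [Nat.cast_sub hle] at h4
    linarith
  -- each term has `Re φ(y yᴴ) ≤ 4`
  have hterm : ∀ p ∈ B, (φ ((((ε (ι p.2) : ℤ) : ℂ) • K p.1 (ι p.2)) * (((ε (ι p.2) : ℤ) : ℂ) • K p.1 (ι p.2))ᴴ)).re ≤ 4 := by
    intro p _
    have hεε : ((ε (ι p.2) : ℤ) : ℂ) * star ((ε (ι p.2) : ℤ) : ℂ) = 1 := by
      rcases Int.units_eq_one_or (ε (ι p.2)) with h | h <;> simp [h]
    rw [conjTranspose_smul, smul_mul_assoc, mul_smul_comm, smul_smul, hεε, one_smul]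
    exact re_map_pairCreationBond_mul_conjTranspose_le_four φ hφ hφH hφ1 p.1 (ι p.2)
  have hsum := re_map_sum_mul_conjTranspose_le φ hφ hφH B (fun p => ((ε (ι p.2) : ℤ) : ℂ) • K p.1 (ι p.2))
  have hsum' : ∑ p ∈ B, (φ ((((ε (ι p.2) : ℤ) : ℂ) • K p.1 (ι p.2)) * (((ε (ι p.2) : ℤ) : ℂ) • K p.1 (ι p.2))ᴴ)).re ≤
      #B * 4 := by
    have := sum_le_sum hterm
    rwa [sum_const, nsmul_eq_mul] at this
  have hB0 : (0 : ℝ) ≤ #B := Nat.cast_nonneg _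
  simp only [hK] at hD hsum hsum'
  rw [hD]
  calc _ ≤ (#B : ℝ) * ∑ p ∈ B, _ := hsum
    _ ≤ (#B : ℝ) * (#B * 4) := mul_le_mul_of_nonneg_left hsum' hB0
    _ = 4 * (#B : ℝ) ^ 2 := by ring
    _ ≤ 4 * ((k : ℝ) * (Fintype.card V - Fintype.card W)) ^ 2 := by
        have := mul_self_le_mul_self hB0 hcardB
        nlinarith [this]

/-- **THE MECHANISM (abstract form).** Let `φ` be a normalised Hermitian positive functional on the CAR matrices
of a finite vertex set, `P = Σ_w ε_{ι w} c†_{ι w↑} c†_{ι w↓}` the restricted pair-creator sum (sign bipartite on the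
inner bonds, at most `k` inner neighbours per site) and `2μ < U`. If `φ` is LOCALLY STABLE against `Pᴴ` for
`K = H(1,U) − μN`, i.e. `Re φ(P (K Pᴴ − Pᴴ K)) ≥ 0` (the Bratteli–Robinson ground-state inequality for the test
operator `A = Pᴴ = η_W`), then
`Re φ(P Pᴴ) ≤ 4 (k (|V| − |W|))² / (U − 2μ)²`:
removing the `η`-pairs of `W` would gain `(U − 2μ) φ(P Pᴴ)` in the bulk, and only the boundary term can pay for it.
[cite: BratteliRobinsonII1997, Prop. 5.3.19] [cite: Yang1989, eq. (6)] -/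
theorem re_map_restrictedEtaRaise_mul_conjTranspose_le (hφ : ∀ A, 0 ≤ φ (Aᴴ * A))
    (hφH : ∀ A, φ Aᴴ = star (φ A)) (hφ1 : φ 1 = 1) (G : SimpleGraph V) [DecidableRel G.Adj] (ι : W ↪ V)
    (ε : V → ℤˣ) (hε : ∀ w w' : W, G.Adj (ι w) (ι w') → ε (ι w) = -ε (ι w')) (k : ℕ)
    (hdeg : ∀ x : V, #(univ.filter fun w : W => G.Adj x (ι w)) ≤ k) {U μ : ℝ} (hμ : 2 * μ < U)
    (hBR : 0 ≤ (φ ((∑ w, ((ε (ι w) : ℤ) : ℂ) • (creation (orb (ι w) 0) * creation (orb (ι w) 1))) *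
      ((hamiltonian G 1 U - (μ : ℂ) • (totalNumber : Matrix (Finset (Orb V)) (Finset (Orb V)) ℂ)) *
          (∑ w, ((ε (ι w) : ℤ) : ℂ) • (creation (orb (ι w) 0) * creation (orb (ι w) 1)))ᴴ -
        (∑ w, ((ε (ι w) : ℤ) : ℂ) • (creation (orb (ι w) 0) * creation (orb (ι w) 1)))ᴴ *
          (hamiltonian G 1 U - (μ : ℂ) • (totalNumber : Matrix (Finset (Orb V)) (Finset (Orb V)) ℂ))))).re) :
    (φ ((∑ w, ((ε (ι w) : ℤ) : ℂ) • (creation (orb (ι w) 0) * creation (orb (ι w) 1))) *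
        (∑ w, ((ε (ι w) : ℤ) : ℂ) • (creation (orb (ι w) 0) * creation (orb (ι w) 1)))ᴴ)).re ≤
      4 * ((k : ℝ) * (Fintype.card V - Fintype.card W)) ^ 2 / (U - 2 * μ) ^ 2 := by
  set P := ∑ w, ((ε (ι w) : ℤ) : ℂ) • (creation (orb (ι w) 0) * creation (orb (ι w) 1)) with hP
  set D := ∑ x ∈ (univ.map ι)ᶜ, ∑ w, (if G.Adj x (ι w) then
    ((ε (ι w) : ℤ) : ℂ) • (creation (orb x 0) * creation (orb (ι w) 1) - creation (orb x 1) * creation (orb (ι w) 0))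
    else 0) with hD
  set Hμ := hamiltonian G 1 U - (μ : ℂ) • (totalNumber : Matrix (Finset (Orb V)) (Finset (Orb V)) ℂ) with hHμ
  have hcomm : Hμ * P - P * Hμ = ((U - 2 * μ : ℝ) : ℂ) • P - D :=
    hamiltonianMu_commutator_restrictedEtaRaise G ι ε hε U μ
  have hHerm : Hμᴴ = Hμ := by
    rw [hHμ, conjTranspose_sub, conjTranspose_smul, (hamiltonian_isHermitian_and_commute_holds G 1 U).1.eq,
      totalNumber_isHermitian.eq, Complex.star_def, Complex.conj_ofReal]
  have hflip : Hμ * Pᴴ - Pᴴ * Hμ = -(((U - 2 * μ : ℝ) : ℂ) • Pᴴ) + Dᴴ := by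
    have h := congrArg conjTranspose hcomm
    rw [conjTranspose_sub, conjTranspose_mul, conjTranspose_mul, hHerm, conjTranspose_sub, conjTranspose_smul,
      Complex.star_def, Complex.conj_ofReal] at h
    calc Hμ * Pᴴ - Pᴴ * Hμ = -(Pᴴ * Hμ - Hμ * Pᴴ) := by abel
      _ = -(((U - 2 * μ : ℝ) : ℂ) • Pᴴ - Dᴴ) := by rw [h]
      _ = -(((U - 2 * μ : ℝ) : ℂ) • Pᴴ) + Dᴴ := by abel
  rw [hflip, mul_add, mul_neg, mul_smul_comm, map_add, map_neg, map_smul, Complex.add_re, Complex.neg_re,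
    smul_eq_mul, Complex.re_ofReal_mul] at hBR
  have ham := re_map_mul_conjTranspose_amgm φ hφ hφH P D (U - 2 * μ)
  have hbd := re_map_boundary_mul_conjTranspose_le φ hφ hφH hφ1 G ι ε k hdeg
  rw [← hD] at hbd
  have hc : 0 < U - 2 * μ := by linarith
  set a := (φ (P * Pᴴ)).re
  set e := (φ (P * Dᴴ)).re
  set b := (φ (D * Dᴴ)).re
  have h1 : (U - 2 * μ) * a ≤ e := by linarith
  have h2 : 2 * (U - 2 * μ) * ((U - 2 * μ) * a) ≤ 2 * (U - 2 * μ) * e :=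
    mul_le_mul_of_nonneg_left h1 (by linarith)
  have h3 : (U - 2 * μ) ^ 2 * a ≤ b := by nlinarith
  rw [le_div_iff₀ (pow_pos hc 2)]
  nlinarith

end Functional

end Literature.MathematicalPhysics.QuantumLattice

end
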